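import Literature.AnabelianGeometry.EtaleTheta.ConstantsDictionary
import Literature.AnabelianGeometry.EtaleTheta.Discharge.Sec5OfConnectedTemperoid
import Literature.AnabelianGeometry.EtaleTheta.ConstantsReadingOfBaseFieldHull
import HarnessLib

/-!
# [EtTh] §5 ↔ §3: the `ConstantsDictionary` of Lemma 5.8 HOLDS at the base-field-theoretic hull of a theta setting (p.331 / PDF p.105) —
# a GENERIC-CARRIER knit from a reading of the birational units, and the knit at the hull (proof-only)

S. Mochizuki, *The étale theta function and its Frobenioid-theoretic manifestations*, Publ. RIMS **45** (2009) [MochizukiEtTh2009]: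
Lemma 5.8 p.331 (PDF p.105) («write `(K^×)^{1/N} ⊆ O^×(B_N^birat)` for the subgroup of elements whose `N`-th power lies in the image of the
natural inclusion `K^× → O^×(B_N^birat)`»; proof: «`Π^tp_Y` [i.e., `G_K`, via the natural surjection `Π^tp_Y ↠ G_K`] acts»), Def. 3.6 (iii)
(the constants `K`) and (iv) p.304 (PDF p.78) (the base-field-theoretic hull `C^{bs-fld}`), Def. 4.1 (ii) p.313 (PDF p.87) («the natural
surjective outer homomorphism `Π^tp_X ↠ Aut_D(A^bs)`» for a Galois `A^bs`, restated for `[B_N]^bs` on p.331), Def. 4.1 (iii) (the natural action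
of `Aut_C(B_N)` on `O^×(B_N^birat)`), Def. 5.4 p.327 (PDF p.101) (theta-saturation).  [cite: MochizukiEtTh2009, Lem 5.8 p.331 (PDF p.105); Def 3.6 (iv) p.304 (PDF p.78); Def 5.4 p.327 (PDF p.101)]

abc-iut cell, layer L2 = [EtTh], seat abc-iut-f-142 (gen 11); row (β1) «DICTIONARY KNIT (d) AT THE HULL», FILE 2 of 2 (abc-iut-L2-lead R1394 / R1446 /
R1460 «GO BOTH FILES», R1514, R1540 «B1F1B RE-CUT»).  CREDITS: architecture G/H/S and farm sizing — abc-iut-L2-t12 (gen 13; scratches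
`ScratchGenericKnit.lean` 28ab5b36c36cf879 / `ScratchHullKnitViaGenericReading.lean` 819dec8278a3fdf7); FILE 1 = `ConstantsReadingOfBaseFieldHull.lean`
(p530309, FROZEN — never touched here) and the SHAPES of record of the knit's statement (F2 body e2ae88b054a8f0a1) — abc-iut-f-142 (gen 10);
independent corroboration of the generic-carrier route (generic-`X` form, uniform-typing variant) — abc-iut-f-142 (gen 11, staging
`ScratchF2-GH-uniformS.lean`).  PROOF-ONLY (class (a): 0 `def` / 0 instance / 0 notation / 0 `Prop`-valued definition / 0 sorry; nothing landed is
edited or restated; every step a theorem cited BY NAME).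
* §1 (G) **`ThetaFrobenioid.constantsDictionary_ofConnectedTemperoidData_of_reading`** — the GENERIC-CARRIER knit: for the §5 data
  `ofConnectedTemperoidData` over `mkOfConnectedTemperoid X tf …` of ANY tempered Frobenioid `tf` over `B^temp(Π)⁰` (abc-iut-L2-t4), ANY §2 datum `T`
  along ANY `ιX`/`ι`, and ANY injective reading `ν : O^×(B_N^birat) → ℚ̄_p^×` of the birational units of `B_N` satisfying the TF-level laws
  {`haug`, `hequiv`, `hm`, `hread`, `hreach`, `hroots`}, abc-iut-L2-t11's `BiratAutAction.ConstantsDictionary` holds with `Cst := ⊤` (every birational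
  unit a constant) and `ν̃ := ν`; the `equivariant` law is `hequiv` at `σ := s^⊓-gp_N(ρ(y))`, which lies over `ρ(y)` by the THEOREM `SgpCapSection`
  (`sgpCapSection_ofConnectedTemperoidData`).  Every `𝔉 ↔ tf` identification is paid here once, on small terms.
* §2 (H) the three TF-level laws of FILE 1's reading AT THE `ρ`-COMPATIBLE BASE POINT `readingRho` that (G) consumes, at the hull of ANY tempered `X`
  with augmentation `a` (`BsFldHull.readingRho_constEmb_mem` / `readingRho_constEmb_reaches` — the constants `K^×` read onto `K ⊆ ℚ̄_p`;
  `readingRho_roots_of_fixingSlot` — under the Def. 5.4 slot, every `y ∈ K^×` is the `N`-th power of the reading of an element of `(K^×)^{1/N}`,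
  p527685's `exists_ev_pow_eq_of_fixingSlot` twisted by `a(g_N) ∈ G_K`; gen 10's `roots_of_K` elaboration hotspot disappears once this `obtain` lives
  outside the structure instance).
* §3 (S) **`ThetaFrobenioid.constantsDictionary_hull`** — THE KNIT AT THE BASE-FIELD HULL OF THE SETTING, statement = the SHAPES of record: for the §5
  data `ofConnectedTemperoidData (T := C.thetaEnvData μ hC hS)` (= `ofThetaSettingData`, `ofThetaSettingData_eq`) over
  `mkOfConnectedTemperoid (C.temperedArithmeticGroup e) (BsFldHull.temperedFrobenioid p C.augHuu …) …` (= abc-iut-L2-d3's `hullSetting` for its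
  `A_⊙`, `hullSetting_eq` / `hullFrd_eq`; any `(N,H)`-parameter `NH`, any junction data `θ, Bl, Pl, Rl, Rt`), with `K := D.K`, «the natural inclusion
  `K^× → O^×(B_N^birat)`» := `BsFldHull.constEmb` (so `hconst` is the THEOREM `biratAutModel_constEmb`), `Cst := ⊤`, `ν̃ := readingRho` and
  `m := muReadingEquiv` (FILE 1), under the ONE displayed hypothesis `hsat` — `B_N` is theta-saturated in the sense of the Def. 5.4 fixing slot
  (`a(U_{B_N})` fixes the normal Kummer field `E_N(K₀)` for some `K₀ ⊇ K`; p527685) — := (G) applied to FILE 1's laws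
  (`readingRho_injective`, `readingRho_biratAutModel_of_baseMap` = «`G_K` acts», `coe_muReadingEquiv` = `mu_compat` by construction) and (H), with the
  one knob `(T := C.thetaEnvData μ hC hS)` passed explicitly; `set_option maxHeartbeats 800000` on this declaration only (400000 measured insufficient
  by abc-iut-L2-t12; the budget FILE 1 carries; the cost is the mixed `Γ`-typing `↥C.Huu` / `(C.temperedArithmeticGroup e).Pi` of the statement,
  definitionally equal by `temperedArithmeticGroup_Pi`).
E-LIST RIDERS on FILE 1's header (abc-iut-aud-5 (1)/(3), R1485 — corrections of record, FILE 1's frozen bytes untouched): (1) FILE 1 attributes «the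
natural surjective OUTER homomorphism `Π^tp_X ↠ Aut_D(B_N^bs)`» to Def. 4.1 (ii) p.313 alone; print there has the Galois object `A^bs` («the natural
surjective outer homomorphism», p.313 (PDF p.87) ll.12–15), the object `[B_N]^bs` being p.331's restatement (PDF p.105 ll.40–41), and «outer» is
print's word without emphasis — read FILE 1's quote as this two-locus splice; (3) FILE 1's «`μ_N(B_N) ⊆ (K^×)^{1/N}`» is NOT a literal print string: it
is the immediate consequence of the quotient `(O_K^×)^{1/N}/μ_N(B_N)` DISPLAYED in Lemma 5.8 p.331 (`N`-th powers of torsion units are `1 ∈ K^×`).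
HONEST (β1) PARAGRAPH (R1460 / R1540): this file DISCHARGES the dictionary binder `hD : ConstantsDictionary …` of the cone rows EtTh:Lem5.8 / Thm5.10
(`Discharge/Sec5Lem58NodeAtThetaSettingYdd.lean`) AT ONE CARRIER ONLY — the base-field-theoretic hull of the Setting, a tempered Frobenioid with
GENUINE base `B^temp(Π^tp_X̲̲)⁰`, genuine constants `K ⊆ ℚ̄_p` and genuine Galois action but DEGENERATE divisor geometry (every rational function is a
constant; abc-iut-L2-d3's honest label) — and modulo the displayed slot `hsat`; `hconst` is DISPLAYED there as the theorem
`BsFldHull.biratAutModel_constEmb`; at abc-iut-L2-t9's `temperedFrobenioidSmall` NO such dictionary exists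
(`not_exists_constantsDictionary_of_countable_biratUnits`, p499346).  No discharge of the [EtTh] Lemma 5.8 / Theorem 5.10 K4 residual
{`hD`, `hconst`} is claimed beyond what the statement of §3 says; nothing asserts that this carrier is print's tempered Frobenioid of a Tate curve;
nothing of [EtTh] (a refereed paper) is asserted unconditionally; nothing here bears on [IUTchIII] Cor. 3.12; no side taken; typed ≠ proved.
-/

noncomputable section

namespace Literature.AnabelianGeometry.EtaleTheta

open CategoryTheory Opposite Literature.AlgebraicGeometry.Frobenioids Literature.AnabelianGeometry.SemiGraphs
  Literature.AnabelianGeometry.SemiGraphs.GaloisObjects Literature.AlgebraicGeometry.Frobenioids.QuasiTemperoid.BTempConnected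

universe v₀

namespace ThetaFrobenioid

/-! ## §1 (G) The generic-carrier knit: the dictionary for `ofConnectedTemperoidData` from ANY TF-level reading of `O^×(B_N^birat)` -/

variable {K₀ : Type} [Field K₀] {X : SemiGraphs.TemperedArithmeticGroup.{0} K₀} {D₀ : Type} [Category.{v₀} D₀]
  {V : FrdIMonoidStub.{0}} {T₀ : RealifiedDivisorMonoids (D₀ := D₀) V}
  {VD : FrdICatStub.{1, 0, 0} (ConnectedPart (BTemp X.Pi))}
  {tf : TemperedFrobenioid T₀ (ConnectedPart (BTemp X.Pi)) VD} {hZ : tf.monoidType = MonoidType.Z}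
  {hP : ∀ A : (ConnectedPart (BTemp X.Pi))ᵒᵖ, IsPerfect (tf.Φ.carrier A)}
  {NH : Subgroup (Field.absoluteGaloisGroup K₀) → tf.category → ℕ+ → Prop} {A₀ : tf.category}
  {hA₀ : PreFrobenioid.IsFrobeniusTrivial tf.toElem A₀} {hA₀' : SemiGraphs.IsGaloisObj A₀.base.obj}
  {pullFrac : ∀ {A A' : (BiKummerSetting.mkOfConnectedTemperoid X tf hZ hP NH A₀ hA₀ hA₀').C} (_ : A' ⟶ A),
    (BiKummerSetting.mkOfConnectedTemperoid X tf hZ hP NH A₀ hA₀ hA₀').biratUnits A →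
      (BiKummerSetting.mkOfConnectedTemperoid X tf hZ hP NH A₀ hA₀ hA₀').biratUnits A'}
  {lv N : ℕ+} {T : ThetaEnvData.{0} N}
  {θ : (BiKummerSetting.mkOfConnectedTemperoid X tf hZ hP NH A₀ hA₀ hA₀').biratUnits
    (BiKummerSetting.mkOfConnectedTemperoid X tf hZ hP NH A₀ hA₀ hA₀').Aodot}
  {Bl : (BiKummerSetting.mkOfConnectedTemperoid X tf hZ hP NH A₀ hA₀ hA₀').C}
  {Pl : (BiKummerSetting.mkOfConnectedTemperoid X tf hZ hP NH A₀ hA₀ hA₀').FractionPair θ Bl}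
  {Rl : (BiKummerSetting.mkOfConnectedTemperoid X tf hZ hP NH A₀ hA₀ hA₀').NthRoot θ Pl lv pullFrac}
  (h : ModelFrobenioid.Hypotheses tf.divisorMonoid tf.ratFnFunctor)
  (Q : FrobenioidTheta.ThetaSubquotientStub.{0} (ConnectedPart (BTemp X.Pi))) (odd_l : Odd (lv : ℕ))
  (R : (BiKummerSetting.mkOfConnectedTemperoid X tf hZ hP NH A₀ hA₀ hA₀').NthRoot Rl.root Rl.pair N pullFrac)
  (ιX : T.PiX ≃ₜ* X.Pi) (K' : Type) [Field K'] (constEmb : K'ˣ →* tf.biratUnitsModel R.BN)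
  (constEmb_injective : Function.Injective constEmb)
  (hinvc : ∀ g : Aut R.AN.base,
    pull tf.divisorMonoid g.hom (ModelFrobenioid.div R.pair.num) = ModelFrobenioid.div R.pair.num)
  (hinvp : ∀ y : T.PiX, y ∈ T.PiYdd →
    pull tf.divisorMonoid ((BiKummerSetting.mkOfConnectedTemperoid X tf hZ hP NH A₀ hA₀ hA₀').galoisSurj R.AN.base
      R.αData.isGalois (ιX y)).hom (ModelFrobenioid.div R.pair.den) = ModelFrobenioid.div R.pair.den)
  (hconst : ∀ (e : Aut R.BN) (k : K'ˣ), tf.biratAutModel R.BN e (constEmb k) = constEmb k)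
  {p : ℕ} [Fact p.Prime] {DS : ThetaSetting p} {E : DS.EtaleThetaData} {l : ℕ} (Cu : E.DoubleUnderline l)
  (μ : DS.CyclotomeMod l N) (hC : DS.Compat) (hS : DS.Sec2Hyps) (ι : T.PiX ≃ₜ* (Cu.thetaEnvData μ hC hS).PiX)
  (m : (ofConnectedTemperoidData h Q odd_l R ιX K' constEmb constEmb_injective hinvc hinvp).muTorsion
      (ofConnectedTemperoidData h Q odd_l R ιX K' constEmb constEmb_injective hinvc hinvp).BN N ≃* MuN p N)
  (ν : tf.biratUnitsModel R.BN →* (PadicAlgCl p)ˣ) (a : X.Pi → GQp p)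

/-- **(G) THE GENERIC-CARRIER KNIT of the [EtTh] §5 ↔ §3 `ConstantsDictionary` (abc-iut-L2-t11) for the §5 data `ofConnectedTemperoidData`
(abc-iut-L2-t4) over `mkOfConnectedTemperoid X tf …` — ANY tempered Frobenioid `tf` over `B^temp(Π)⁰`, ANY §2 datum `T` along `ιX : Π_T ≃ Π` and
`ι : Π_T ≃ Π^tp_X̲̲` — from ANY injective reading `ν : O^×(B_N^birat) → ℚ̄_p^×` with: `haug` (the Setting's augmentation along `ι` is `a` along `ιX`),
`hequiv` («`Π^tp_Y` [i.e., `G_K`, via the natural surjection `Π^tp_Y ↠ G_K`] acts», Lemma 5.8 proof: an automorphism of `B_N` lying over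
`ρ(y) = (s^⊓_N)^{bs} ∘ ρ_{A_N}(y) ∘ ((s^⊓_N)^{bs})⁻¹` reads as the Galois action of `a(y)`), `hm` (the reading extends the cyclotome identification
`m : μ_N(B_N) ⥲ μ_N`), `hread`/`hreach` (the constants `K^×` read ONTO `K ⊆ ℚ̄_p`, Def. 3.6 (iii)), `hroots` (every `y ∈ K^×` is the `N`-th power of the
reading of an element of `(K^×)^{1/N}`, Def. 5.4 / Lemma 5.8 «`(K^×)^{1/N} ⊆ O^×(B_N^birat)`»).  Conclusion: the dictionary with `Cst := ⊤`, `ν̃ := ν`;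
`equivariant` at `σ := s^⊓-gp_N(ρ(y))`, over `ρ(y)` by the THEOREM `sgpCapSection_ofConnectedTemperoidData`.
[cite: MochizukiEtTh2009, Lem 5.8 p.331 (PDF p.105); Def 3.6 (iv) p.304 (PDF p.78); Def 4.1 (iii) p.313 (PDF p.87)] -/
theorem constantsDictionary_ofConnectedTemperoidData_of_reading
    (hν : Function.Injective ν)
    (haug : ∀ y : T.PiX, (((Cu.thetaEnvData μ hC hS).aug (ι y) : DS.GK) : GQp p) = a (ιX y))
    (hequiv : ∀ (σ : Aut R.BN) (y : X.Pi),
      ModelFrobenioid.baseMap σ.inv =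
        ((BiKummerSetting.NthRoot.baseIso (BiKummerSetting.mkOfConnectedTemperoid X tf hZ hP NH A₀ hA₀ hA₀') R).conjAut
          ((BiKummerSetting.mkOfConnectedTemperoid X tf hZ hP NH A₀ hA₀ hA₀').galoisSurj R.AN.base R.αData.isGalois y)).inv →
      ∀ u : tf.biratUnitsModel R.BN, ν (tf.biratAutModel R.BN σ u) = a y • ν u)
    (hm : ∀ u : (ofConnectedTemperoidData h Q odd_l R ιX K' constEmb constEmb_injective hinvc hinvp).muTorsion
        (ofConnectedTemperoidData h Q odd_l R ιX K' constEmb constEmb_injective hinvc hinvp).BN N,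
      ν ((ofConnectedTemperoidData h Q odd_l R ιX K' constEmb constEmb_injective hinvc hinvp).muToBirat u) =
        ((m u : MuN p N) : (PadicAlgCl p)ˣ))
    (hread : ∀ k : K'ˣ, ((ν (constEmb k) : (PadicAlgCl p)ˣ) : PadicAlgCl p) ∈ DS.K)
    (hreach : ∀ z : (DS.K)ˣ, ∃ k : K'ˣ,
      ((ν (constEmb k) : (PadicAlgCl p)ˣ) : PadicAlgCl p) = algebraMap DS.K (PadicAlgCl p) (z : DS.K))
    (hroots : ∀ y : (DS.K)ˣ, ∃ f : tf.biratUnitsModel R.BN, (∃ k : K'ˣ, constEmb k = f ^ (N : ℕ)) ∧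
      ((ν f : (PadicAlgCl p)ˣ) : PadicAlgCl p) ^ (N : ℕ) = algebraMap DS.K (PadicAlgCl p) (y : DS.K)) :
    BiratAutAction.ConstantsDictionary
      (biratAutAction_ofConnectedTemperoidData h Q odd_l R ιX K' constEmb constEmb_injective hinvc hinvp hconst)
      Cu μ hC hS ι m ⊤ (ν.comp (⊤ : Subgroup _).subtype) := by
  refine
    { units_mem := fun _ => Subgroup.mem_top _
      constEmb_mem := fun _ => Subgroup.mem_top _
      kxRootN_le := le_top
      act_mem := fun _ _ _ => Subgroup.mem_top _
      injective := fun x x' hxx' => Subtype.ext (hν hxx')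
      equivariant := fun y x => ?_
      mu_compat := fun u => hm u
      constEmb_read := fun k => hread k
      reaches_K := fun z => hreach z
      roots_of_K := fun y => ?_ }
  · -- `σ := s^⊓-gp_N(ρ(y))` lies over `ρ(y)` (`SgpCapSection`), `ρ(y) = (s^⊓_N)^{bs} ∘ galoisSurj(ιX y) ∘ ((s^⊓_N)^{bs})⁻¹`
    have hsec := sgpCapSection_ofConnectedTemperoidData h Q odd_l R ιX K' constEmb constEmb_injective hinvc hinvp
      ((ofConnectedTemperoidData h Q odd_l R ιX K' constEmb constEmb_injective hinvc hinvp).ρ y)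
    have hσ : ModelFrobenioid.baseMap
        ((ofConnectedTemperoidData h Q odd_l R ιX K' constEmb constEmb_injective hinvc hinvp).sgpCap
          ((ofConnectedTemperoidData h Q odd_l R ιX K' constEmb constEmb_injective hinvc hinvp).ρ y)).inv =
        ((BiKummerSetting.NthRoot.baseIso (BiKummerSetting.mkOfConnectedTemperoid X tf hZ hP NH A₀ hA₀ hA₀') R).conjAut
          ((BiKummerSetting.mkOfConnectedTemperoid X tf hZ hP NH A₀ hA₀ hA₀').galoisSurj R.AN.base R.αData.isGalois
            (ιX y))).inv :=
      congrArg Iso.inv hsec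
    exact (hequiv _ (ιX y) hσ x.1).trans (congrArg (fun g : GQp p => g • ν x.1) (haug y).symm)
  · obtain ⟨f, ⟨k, hk⟩, hf⟩ := hroots y
    exact ⟨⟨f, (ofConnectedTemperoidData h Q odd_l R ιX K' constEmb constEmb_injective hinvc hinvp).mem_KxRootN.mpr
      ⟨k, hk⟩⟩, hf⟩

end ThetaFrobenioid

/-! ## §2 (H) Hull side (generic tempered `X`, augmentation `a`): the TF-level laws of `readingRho` in the shapes (G) consumes -/

namespace BsFldHull

variable (p : ℕ) [Fact p.Prime] {K : Type} [Field K] {X : TemperedArithmeticGroup.{0} K} {a : X.Pi →* GQp p}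
  {ha : ∀ U : OpenSubgroup X.Pi, IsOpen ((U.toSubgroup.map a : Subgroup (GQp p)) : Set (GQp p))}
  {Rq Sq : ((ConnectedPart (BTemp X.Pi))ᵒᵖ ⥤ CommMonCat.{0}) → Prop}
  {NH : Subgroup (Field.absoluteGaloisGroup K) → (temperedFrobenioid p a ha X.isTempered Rq Sq).category → ℕ+ → Prop} {A₀ : (temperedFrobenioid p a ha X.isTempered Rq Sq).category}
  {hA₀ : PreFrobenioid.IsFrobeniusTrivial (temperedFrobenioid p a ha X.isTempered Rq Sq).toElem A₀} {hA₀' : IsGaloisObj A₀.base.obj}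
  {pullFrac : ∀ {A A' : (BiKummerSetting.mkOfConnectedTemperoid X (temperedFrobenioid p a ha X.isTempered Rq Sq) (temperedFrobenioid_monoidType p a ha X.isTempered Rq Sq) (hP p a ha X.isTempered Rq Sq) NH A₀ hA₀ hA₀').C} (_ : A' ⟶ A), (BiKummerSetting.mkOfConnectedTemperoid X (temperedFrobenioid p a ha X.isTempered Rq Sq) (temperedFrobenioid_monoidType p a ha X.isTempered Rq Sq) (hP p a ha X.isTempered Rq Sq) NH A₀ hA₀ hA₀').biratUnits A → (BiKummerSetting.mkOfConnectedTemperoid X (temperedFrobenioid p a ha X.isTempered Rq Sq) (temperedFrobenioid_monoidType p a ha X.isTempered Rq Sq) (hP p a ha X.isTempered Rq Sq) NH A₀ hA₀ hA₀').biratUnits A'}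
  {lv N : ℕ+} {θ : (BiKummerSetting.mkOfConnectedTemperoid X (temperedFrobenioid p a ha X.isTempered Rq Sq) (temperedFrobenioid_monoidType p a ha X.isTempered Rq Sq) (hP p a ha X.isTempered Rq Sq) NH A₀ hA₀ hA₀').biratUnits (BiKummerSetting.mkOfConnectedTemperoid X (temperedFrobenioid p a ha X.isTempered Rq Sq) (temperedFrobenioid_monoidType p a ha X.isTempered Rq Sq) (hP p a ha X.isTempered Rq Sq) NH A₀ hA₀ hA₀').Aodot} {Bl : (BiKummerSetting.mkOfConnectedTemperoid X (temperedFrobenioid p a ha X.isTempered Rq Sq) (temperedFrobenioid_monoidType p a ha X.isTempered Rq Sq) (hP p a ha X.isTempered Rq Sq) NH A₀ hA₀ hA₀').C} {Pl : (BiKummerSetting.mkOfConnectedTemperoid X (temperedFrobenioid p a ha X.isTempered Rq Sq) (temperedFrobenioid_monoidType p a ha X.isTempered Rq Sq) (hP p a ha X.isTempered Rq Sq) NH A₀ hA₀ hA₀').FractionPair θ Bl} {Rl : (BiKummerSetting.mkOfConnectedTemperoid X (temperedFrobenioid p a ha X.isTempered Rq Sq) (temperedFrobenioid_monoidType p a ha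 X.isTempered Rq Sq) (hP p a ha X.isTempered Rq Sq) NH A₀ hA₀ hA₀').NthRoot θ Pl lv pullFrac}
  (Rt : (BiKummerSetting.mkOfConnectedTemperoid X (temperedFrobenioid p a ha X.isTempered Rq Sq) (temperedFrobenioid_monoidType p a ha X.isTempered Rq Sq) (hP p a ha X.isTempered Rq Sq) NH A₀ hA₀ hA₀').NthRoot Rl.root Rl.pair N pullFrac)
  (Kc : IntermediateField ℚ_[p] (PadicAlgCl p)) (hKc : ∀ g : X.Pi, a g ∈ Kc.fixingSubgroup)

/-- **The constants `K^×` of the hull read INTO `K ⊆ ℚ̄_p` at `x^ρ_{B_N}`** (FILE 1's `readingRho_constEmb`; Def. 3.6 (iii): the constant field is `K`).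
[cite: MochizukiEtTh2009, Def 3.6 (iv) p.304 (PDF p.78); Lem 5.8 p.331 (PDF p.105)] -/
theorem readingRho_constEmb_mem (k : (Kc)ˣ) :
    ((readingRho p Rt (constEmb p a ha Kc hKc X.isTempered Rq Sq Rt.BN k) : (PadicAlgCl p)ˣ) : PadicAlgCl p) ∈ Kc := by
  rw [readingRho_constEmb, coe_unitsOfK]
  exact (k : Kc).2

/-- **… and ONTO `K^×`**: every `z ∈ K^×` is the reading at `x^ρ_{B_N}` of the constant `constEmb z`. [cite: MochizukiEtTh2009, Def 3.6 (iv) p.304 (PDF p.78); Lem 5.8 p.331 (PDF p.105)] -/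
theorem readingRho_constEmb_reaches (z : (Kc)ˣ) : ∃ k : (Kc)ˣ,
    ((readingRho p Rt (constEmb p a ha Kc hKc X.isTempered Rq Sq Rt.BN k) : (PadicAlgCl p)ˣ) : PadicAlgCl p) =
      algebraMap Kc (PadicAlgCl p) (z : Kc) :=
  ⟨z, by rw [readingRho_constEmb, coe_unitsOfK]; rfl⟩

/-- **`roots_of_K` at the hull, read at `x^ρ_{B_N}`** (Lemma 5.8 «`(K^×)^{1/N} ⊆ O^×(B_N^birat)`»; Def. 5.4): if `a(U_{B_N})` fixes the normal Kummer field
`E_N(K₀)` (the Def. 5.4 slot `hsat`, p527685) and `K ≤ K₀`, every `y ∈ K^×` is the `N`-th power of the reading of a birational unit `f` of `B_N` with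
`f^N = constEmb y` — p527685's `exists_ev_pow_eq_of_fixingSlot` (a constant function `b` with `b^N = y`), twisted by `a(g_N) ∈ G_K`, which fixes `K`.
[cite: MochizukiEtTh2009, Lem 5.8 p.331 (PDF p.105); Def 5.4 p.327 (PDF p.101)] -/
theorem readingRho_roots_of_fixingSlot {K₀ : IntermediateField ℚ_[p] (PadicAlgCl p)} (hK₀ : Kc ≤ K₀)
    (hsat : (((CosetCat.equivConnectedPart X.isTempered).inverse.obj Rt.BN.base).sg.toSubgroup.map a :
        Subgroup (GQp p)) ≤
      (IntermediateField.normalClosure ℚ_[p]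
        (IntermediateField.adjoin ℚ_[p] ((K₀ : Set (PadicAlgCl p)) ∪ {x | x ^ (N : ℕ) ∈ K₀})) (PadicAlgCl p)).fixingSubgroup)
    (y : (Kc)ˣ) :
    ∃ f : (temperedFrobenioid p a ha X.isTempered Rq Sq).biratUnitsModel Rt.BN,
      (∃ k : (Kc)ˣ, constEmb p a ha Kc hKc X.isTempered Rq Sq Rt.BN k = f ^ (N : ℕ)) ∧
      ((readingRho p Rt f : (PadicAlgCl p)ˣ) : PadicAlgCl p) ^ (N : ℕ) = algebraMap Kc (PadicAlgCl p) (y : Kc) := by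
  obtain ⟨b, hb⟩ := exists_ev_pow_eq_of_fixingSlot p a hK₀ N
    ((CosetCat.equivConnectedPart X.isTempered).inverse.obj Rt.BN.base) hsat (unitsOfK p Kc y) (y : Kc).2
  -- `b ^ N` is the constant function with value `y`
  have hbN : b ^ (N : ℕ) = constFun p a Kc hKc ((CosetCat.equivConnectedPart X.isTempered).inverse.obj Rt.BN.base) y := by
    apply ev_injective p a ((CosetCat.equivConnectedPart X.isTempered).inverse.obj Rt.BN.base)
    rw [ev_constFun]
    apply Units.ext
    rw [map_pow, Units.val_pow_eq_pow_val, hb, coe_unitsOfK]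
  refine ⟨unitsEquiv p a ha X.isTempered Rq Sq Rt.BN b, ⟨y, ?_⟩, ?_⟩
  · rw [← map_pow, hbN]
    rfl
  · rw [readingRho_apply, reading_unitsEquiv]
    change (a (offsetElt p Rt) (((ev p a _ b : (PadicAlgCl p)ˣ) : PadicAlgCl p))) ^ (N : ℕ) = _
    rw [← map_pow, hb, coe_unitsOfK]
    exact (IntermediateField.mem_fixingSubgroup_iff _ _).mp (hKc (offsetElt p Rt)) _ (y : Kc).2

end BsFldHull

/-! ## §3 (S) The knit AT THE BASE-FIELD HULL OF THE SETTING (`X := Π^tp_X̲̲`, `a := augHuu`, `T := C.thetaEnvData μ hC hS`, `ι = ιX := id`) -/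

namespace ThetaFrobenioid

section HullKnit

variable {p : ℕ} [Fact p.Prime] {D : ThetaSetting p} {E : D.EtaleThetaData} {l : ℕ} {C : E.DoubleUnderline l}
  {e : D.toTemperedCurve.GroupLevelData} {N : ℕ+} (μ : D.CyclotomeMod l N) (hC : D.Compat) (hS : D.Sec2Hyps)
  {Rq Sq : ((ConnectedPart (BTemp (C.temperedArithmeticGroup e).Pi))ᵒᵖ ⥤ CommMonCat.{0}) → Prop}
  {NH : Subgroup (Field.absoluteGaloisGroup D.K) → (BsFldHull.temperedFrobenioid p C.augHuu (C.isOpen_map_augHuu e) (C.temperedArithmeticGroup e).isTempered Rq Sq).category → ℕ+ → Prop}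
  {A₀ : (BsFldHull.temperedFrobenioid p C.augHuu (C.isOpen_map_augHuu e) (C.temperedArithmeticGroup e).isTempered Rq Sq).category} {hA₀ : PreFrobenioid.IsFrobeniusTrivial (BsFldHull.temperedFrobenioid p C.augHuu (C.isOpen_map_augHuu e) (C.temperedArithmeticGroup e).isTempered Rq Sq).toElem A₀} {hA₀' : IsGaloisObj A₀.base.obj}
  {pullFrac : ∀ {A A' : (BiKummerSetting.mkOfConnectedTemperoid (C.temperedArithmeticGroup e) (BsFldHull.temperedFrobenioid p C.augHuu (C.isOpen_map_augHuu e) (C.temperedArithmeticGroup e).isTempered Rq Sq) (BsFldHull.temperedFrobenioid_monoidType p C.augHuu (C.isOpen_map_augHuu e) (C.temperedArithmeticGroup e).isTempered Rq Sq) (BsFldHull.hP p C.augHuu (C.isOpen_map_augHuu e) (C.temperedArithmeticGroup e).isTempered Rq Sq) NH A₀ hA₀ hA₀').C} (_ : A' ⟶ A), (BiKummerSetting.mkOfConnectedTemperoid (C.temperedArithmeticGroup e) (BsFldHull.temperedFrobenioid p C.augHuu (C.isOpen_map_augHuu e) (C.temperedArithmeticGroup e).isTempered Rq Sq) (BsFldHull.temperedFrobenioid_monoidType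 p C.augHuu (C.isOpen_map_augHuu e) (C.temperedArithmeticGroup e).isTempered Rq Sq) (BsFldHull.hP p C.augHuu (C.isOpen_map_augHuu e) (C.temperedArithmeticGroup e).isTempered Rq Sq) NH A₀ hA₀ hA₀').biratUnits A → (BiKummerSetting.mkOfConnectedTemperoid (C.temperedArithmeticGroup e) (BsFldHull.temperedFrobenioid p C.augHuu (C.isOpen_map_augHuu e) (C.temperedArithmeticGroup e).isTempered Rq Sq) (BsFldHull.temperedFrobenioid_monoidType p C.augHuu (C.isOpen_map_augHuu e) (C.temperedArithmeticGroup e).isTempered Rq Sq) (BsFldHull.hP p C.augHuu (C.isOpen_map_augHuu e) (C.temperedArithmeticGroup e).isTempered Rq Sq) NH A₀ hA₀ hA₀').biratUnits A'}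
  {θ : (BiKummerSetting.mkOfConnectedTemperoid (C.temperedArithmeticGroup e) (BsFldHull.temperedFrobenioid p C.augHuu (C.isOpen_map_augHuu e) (C.temperedArithmeticGroup e).isTempered Rq Sq) (BsFldHull.temperedFrobenioid_monoidType p C.augHuu (C.isOpen_map_augHuu e) (C.temperedArithmeticGroup e).isTempered Rq Sq) (BsFldHull.hP p C.augHuu (C.isOpen_map_augHuu e) (C.temperedArithmeticGroup e).isTempered Rq Sq) NH A₀ hA₀ hA₀').biratUnits (BiKummerSetting.mkOfConnectedTemperoid (C.temperedArithmeticGroup e) (BsFldHull.temperedFrobenioid p C.augHuu (C.isOpen_map_augHuu e) (C.temperedArithmeticGroup e).isTempered Rq Sq) (BsFldHull.temperedFrobenioid_monoidType p C.augHuu (C.isOpen_map_augHuu e) (C.temperedArithmeticGroup e).isTempered Rq Sq) (BsFldHull.hP p C.augHuu (C.isOpen_map_augHuu e) (C.temperedArithmeticGroup e).isTempered Rq Sq) NH A₀ hA₀ hA₀').Aodot} {Bl : (BiKummerSetting.mkOfConnectedTemperoid (C.temperedArithmeticGroup e) (BsFldHull.temperedFrobenioid p C.augHuu (C.isOpen_map_augHuu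 e) (C.temperedArithmeticGroup e).isTempered Rq Sq) (BsFldHull.temperedFrobenioid_monoidType p C.augHuu (C.isOpen_map_augHuu e) (C.temperedArithmeticGroup e).isTempered Rq Sq) (BsFldHull.hP p C.augHuu (C.isOpen_map_augHuu e) (C.temperedArithmeticGroup e).isTempered Rq Sq) NH A₀ hA₀ hA₀').C} {Pl : (BiKummerSetting.mkOfConnectedTemperoid (C.temperedArithmeticGroup e) (BsFldHull.temperedFrobenioid p C.augHuu (C.isOpen_map_augHuu e) (C.temperedArithmeticGroup e).isTempered Rq Sq) (BsFldHull.temperedFrobenioid_monoidType p C.augHuu (C.isOpen_map_augHuu e) (C.temperedArithmeticGroup e).isTempered Rq Sq) (BsFldHull.hP p C.augHuu (C.isOpen_map_augHuu e) (C.temperedArithmeticGroup e).isTempered Rq Sq) NH A₀ hA₀ hA₀').FractionPair θ Bl} {Rl : (BiKummerSetting.mkOfConnectedTemperoid (C.temperedArithmeticGroup e) (BsFldHull.temperedFrobenioid p C.augHuu (C.isOpen_map_augHuu e) (C.temperedArithmeticGroup e).isTempered Rq Sq) (BsFldHull.temperedFrobenioid_monoidType p C.augHuu (C.isOpen_map_augHuu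 e) (C.temperedArithmeticGroup e).isTempered Rq Sq) (BsFldHull.hP p C.augHuu (C.isOpen_map_augHuu e) (C.temperedArithmeticGroup e).isTempered Rq Sq) NH A₀ hA₀ hA₀').NthRoot θ Pl C.lPNat pullFrac}
  (Q : FrobenioidTheta.ThetaSubquotientStub.{0} (ConnectedPart (BTemp (C.temperedArithmeticGroup e).Pi)))
  (Rt : (BiKummerSetting.mkOfConnectedTemperoid (C.temperedArithmeticGroup e) (BsFldHull.temperedFrobenioid p C.augHuu (C.isOpen_map_augHuu e) (C.temperedArithmeticGroup e).isTempered Rq Sq) (BsFldHull.temperedFrobenioid_monoidType p C.augHuu (C.isOpen_map_augHuu e) (C.temperedArithmeticGroup e).isTempered Rq Sq) (BsFldHull.hP p C.augHuu (C.isOpen_map_augHuu e) (C.temperedArithmeticGroup e).isTempered Rq Sq) NH A₀ hA₀ hA₀').NthRoot Rl.root Rl.pair N pullFrac)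
  (hinvc : ∀ g : Aut Rt.AN.base,
    pull (BsFldHull.temperedFrobenioid p C.augHuu (C.isOpen_map_augHuu e) (C.temperedArithmeticGroup e).isTempered Rq Sq).divisorMonoid g.hom (ModelFrobenioid.div Rt.pair.num) = ModelFrobenioid.div Rt.pair.num)
  (hinvp : ∀ y : (C.thetaEnvData μ hC hS).PiX, y ∈ (C.thetaEnvData μ hC hS).PiYdd →
    pull (BsFldHull.temperedFrobenioid p C.augHuu (C.isOpen_map_augHuu e) (C.temperedArithmeticGroup e).isTempered Rq Sq).divisorMonoid ((BiKummerSetting.mkOfConnectedTemperoid (C.temperedArithmeticGroup e) (BsFldHull.temperedFrobenioid p C.augHuu (C.isOpen_map_augHuu e) (C.temperedArithmeticGroup e).isTempered Rq Sq) (BsFldHull.temperedFrobenioid_monoidType p C.augHuu (C.isOpen_map_augHuu e) (C.temperedArithmeticGroup e).isTempered Rq Sq) (BsFldHull.hP p C.augHuu (C.isOpen_map_augHuu e) (C.temperedArithmeticGroup e).isTempered Rq Sq) NH A₀ hA₀ hA₀').galoisSurj Rt.AN.base Rt.αData.isGalois ((ContinuousMulEquiv.refl _) y)).hom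
      (ModelFrobenioid.div Rt.pair.den) = ModelFrobenioid.div Rt.pair.den)
  (K₀ : IntermediateField ℚ_[p] (PadicAlgCl p)) (hK₀ : D.K ≤ K₀)
  (hsat : (((CosetCat.equivConnectedPart (C.temperedArithmeticGroup e).isTempered).inverse.obj Rt.BN.base).sg.toSubgroup.map C.augHuu :
      Subgroup (GQp p)) ≤
    (IntermediateField.normalClosure ℚ_[p]
      (IntermediateField.adjoin ℚ_[p] ((K₀ : Set (PadicAlgCl p)) ∪ {x | x ^ (N : ℕ) ∈ K₀})) (PadicAlgCl p)).fixingSubgroup)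

/-- `a(Π^tp_X̲̲) ≤ G_K` for the augmentation `augHuu` of the Setting (`range aug = G_K`; §5 p.322 «geometrically connected over `K`»): the `hK` input of
abc-iut-L2-d3's `BsFldHull.constEmb`. [cite: MochizukiEtTh2009, §5 p.322 (PDF p.96)] -/
theorem augHuu_mem_fixingSubgroup (g : C.Huu) : C.augHuu g ∈ (D.K).fixingSubgroup := D.aug_mem_GK (g : D.PiTemp)

include hsat in
/-- The Def. 5.4 slot at `B_N` puts every `N`-th root of unity of `ℚ̄_p` among the constants of `B_N`: `μ_N(ℚ̄_p) ⊆ K_{U_{B_N}}` (the hypothesis `hμN`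
of FILE 1's `BsFldHull.muReadingEquiv`; p527685's `le_fixFld_of_map_le_fixingSubgroup` + `mem_normalClosure_adjoin_of_pow_eq_one`).
[cite: MochizukiEtTh2009, Def 5.4 p.327 (PDF p.101)] -/
theorem hμN_of_fixingSlot (ζ : PadicAlgCl p) (hζ : ζ ^ (N : ℕ) = 1) :
    ζ ∈ BsFldHull.fixFld p C.augHuu ((CosetCat.equivConnectedPart (C.temperedArithmeticGroup e).isTempered).inverse.obj Rt.BN.base).sg :=
  BsFldHull.le_fixFld_of_map_le_fixingSubgroup p C.augHuu _ hsat (BsFldHull.mem_normalClosure_adjoin_of_pow_eq_one p K₀ N hζ)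

include hK₀ in
set_option maxHeartbeats 800000 in
/-- **(S) THE `ConstantsDictionary` OF [EtTh] §5 ↔ §3 HOLDS AT THE BASE-FIELD-THEORETIC HULL OF THE SETTING** (abc-iut-L2-t11's frozen predicate,
p439403) for the §5 data `ofConnectedTemperoidData (T := C.thetaEnvData μ hC hS)` (= `ofThetaSettingData`) of the Setting over
`mkOfConnectedTemperoid (C.temperedArithmeticGroup e) (BsFldHull.temperedFrobenioid p C.augHuu …) …` (= abc-iut-L2-d3's `hullSetting` for its `A_⊙`;
any `(N,H)`-parameter, any junction data `θ, Bl, Pl, Rl, Rt`), with `K := D.K`, «the natural inclusion `K^× → O^×(B_N^birat)`» := abc-iut-L2-d3's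
`BsFldHull.constEmb` (so `hconst` is the THEOREM `biratAutModel_constEmb`), `Cst := ⊤` (every birational unit of the hull is a constant), the
reading `ν̃ := readingRho` AT THE `ρ`-COMPATIBLE BASE POINT and the cyclotome identification `m := muReadingEquiv` (FILE 1) — under the ONE displayed
hypothesis `hsat`: `B_N` is theta-saturated in the sense of the Def. 5.4 fixing slot (`a(U_{B_N})` fixes `E_N(K₀)` for some `K₀ ⊇ K`; p527685).
Laws: `units_mem`/`constEmb_mem`/`kxRootN_le`/`act_mem` trivial at `Cst = ⊤`; `injective` = `readingRho_injective`; `equivariant` =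
`readingRho_biratAutModel_of_baseMap` («`Π^tp_Y` [i.e., `G_K`] acts») through (G); `mu_compat` = `coe_muReadingEquiv` (by construction of `m`);
`constEmb_read`/`reaches_K`/`roots_of_K` = §2 (H).  := (G) with the one knob `(T := C.thetaEnvData μ hC hS)` explicit.  HONEST: a discharge of `hD` at THIS
carrier (degenerate divisor geometry) modulo `hsat`, nothing more; no side taken on [IUTchIII] Cor. 3.12; typed ≠ proved.
[cite: MochizukiEtTh2009, Lem 5.8 p.331 (PDF p.105); Def 3.6 (iv) p.304 (PDF p.78); Def 5.4 p.327 (PDF p.101)] -/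
theorem constantsDictionary_hull :
    BiratAutAction.ConstantsDictionary
      (biratAutAction_ofConnectedTemperoidData (T := C.thetaEnvData μ hC hS) (BsFldHull.hypotheses p C.augHuu (C.isOpen_map_augHuu e) (C.temperedArithmeticGroup e).isTempered Rq Sq) Q C.odd_lPNat Rt
        (ContinuousMulEquiv.refl _) (D.K)
        (BsFldHull.constEmb p C.augHuu (C.isOpen_map_augHuu e) D.K augHuu_mem_fixingSubgroup (C.temperedArithmeticGroup e).isTempered Rq Sq Rt.BN)
        (BsFldHull.constEmb_injective p C.augHuu (C.isOpen_map_augHuu e) D.K augHuu_mem_fixingSubgroup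
          (C.temperedArithmeticGroup e).isTempered Rq Sq Rt.BN)
        hinvc hinvp
        (BsFldHull.biratAutModel_constEmb p C.augHuu (C.isOpen_map_augHuu e) D.K augHuu_mem_fixingSubgroup
          (C.temperedArithmeticGroup e).isTempered Rq Sq Rt.BN))
      C μ hC hS (ContinuousMulEquiv.refl _)
      (BsFldHull.muReadingEquiv (T := C.thetaEnvData μ hC hS) p Rt (BsFldHull.hypotheses p C.augHuu (C.isOpen_map_augHuu e) (C.temperedArithmeticGroup e).isTempered Rq Sq) Q C.odd_lPNat (ContinuousMulEquiv.refl _) (D.K)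
        (BsFldHull.constEmb p C.augHuu (C.isOpen_map_augHuu e) D.K augHuu_mem_fixingSubgroup (C.temperedArithmeticGroup e).isTempered Rq Sq Rt.BN)
        (BsFldHull.constEmb_injective p C.augHuu (C.isOpen_map_augHuu e) D.K augHuu_mem_fixingSubgroup
          (C.temperedArithmeticGroup e).isTempered Rq Sq Rt.BN)
        hinvc hinvp (hμN_of_fixingSlot Rt K₀ hsat))
      ⊤ ((BsFldHull.readingRho p Rt).comp (⊤ : Subgroup _).subtype) :=
  constantsDictionary_ofConnectedTemperoidData_of_reading (T := C.thetaEnvData μ hC hS)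
    (BsFldHull.hypotheses p C.augHuu (C.isOpen_map_augHuu e) (C.temperedArithmeticGroup e).isTempered Rq Sq) Q C.odd_lPNat Rt
    (ContinuousMulEquiv.refl _) (D.K)
    (BsFldHull.constEmb p C.augHuu (C.isOpen_map_augHuu e) D.K augHuu_mem_fixingSubgroup (C.temperedArithmeticGroup e).isTempered Rq Sq Rt.BN)
    (BsFldHull.constEmb_injective p C.augHuu (C.isOpen_map_augHuu e) D.K augHuu_mem_fixingSubgroup
      (C.temperedArithmeticGroup e).isTempered Rq Sq Rt.BN)
    hinvc hinvp
    (BsFldHull.biratAutModel_constEmb p C.augHuu (C.isOpen_map_augHuu e) D.K augHuu_mem_fixingSubgroup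
      (C.temperedArithmeticGroup e).isTempered Rq Sq Rt.BN)
    C μ hC hS (ContinuousMulEquiv.refl _)
    (BsFldHull.muReadingEquiv (T := C.thetaEnvData μ hC hS) p Rt (BsFldHull.hypotheses p C.augHuu (C.isOpen_map_augHuu e) (C.temperedArithmeticGroup e).isTempered Rq Sq) Q C.odd_lPNat (ContinuousMulEquiv.refl _) (D.K)
      (BsFldHull.constEmb p C.augHuu (C.isOpen_map_augHuu e) D.K augHuu_mem_fixingSubgroup (C.temperedArithmeticGroup e).isTempered Rq Sq Rt.BN)
      (BsFldHull.constEmb_injective p C.augHuu (C.isOpen_map_augHuu e) D.K augHuu_mem_fixingSubgroup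
        (C.temperedArithmeticGroup e).isTempered Rq Sq Rt.BN)
      hinvc hinvp (hμN_of_fixingSlot Rt K₀ hsat))
    (BsFldHull.readingRho p Rt) (fun y => C.augHuu y)
    (BsFldHull.readingRho_injective p Rt)
    (fun _ => rfl)
    (fun σ y hσ u => BsFldHull.readingRho_biratAutModel_of_baseMap p Rt σ y hσ u)
    (fun u => (BsFldHull.coe_muReadingEquiv (T := C.thetaEnvData μ hC hS) p Rt
      (BsFldHull.hypotheses p C.augHuu (C.isOpen_map_augHuu e) (C.temperedArithmeticGroup e).isTempered Rq Sq) Q C.odd_lPNat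
      (ContinuousMulEquiv.refl _) (D.K)
      (BsFldHull.constEmb p C.augHuu (C.isOpen_map_augHuu e) D.K augHuu_mem_fixingSubgroup (C.temperedArithmeticGroup e).isTempered Rq Sq Rt.BN)
      (BsFldHull.constEmb_injective p C.augHuu (C.isOpen_map_augHuu e) D.K augHuu_mem_fixingSubgroup
        (C.temperedArithmeticGroup e).isTempered Rq Sq Rt.BN)
      hinvc hinvp (hμN_of_fixingSlot Rt K₀ hsat) u).symm)
    (BsFldHull.readingRho_constEmb_mem p Rt D.K augHuu_mem_fixingSubgroup)
    (BsFldHull.readingRho_constEmb_reaches p Rt D.K augHuu_mem_fixingSubgroup)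
    (BsFldHull.readingRho_roots_of_fixingSlot p Rt D.K augHuu_mem_fixingSubgroup hK₀ hsat)

end HullKnit

end ThetaFrobenioid

end Literature.AnabelianGeometry.EtaleTheta

end
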